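import Literature.AnabelianGeometry.AbsoluteAnabelian.NFDecompositionCommTerminalProofs
import Literature.NumberTheory.GaloisRepresentations.DecompositionGroupNested
import HarnessLib

/-!
# [AbsAnab] §1.1 / [NSW] XII §1: nested decomposition groups of nonarchimedean primes are equal;
# the group-theoretic step of Neukirch's theorem — valuation-subring form

Mochizuki, *The absolute anabelian geometry of hyperbolic curves* (2004), §1.1 (decomposition
groups `G_𝔭 ⊆ G_F` of the nonarchimedean primes `𝔭` of `F̄`, `F` a number field; Thm. 1.1.3
quotes the Neukirch–Uchida theorem); Neukirch–Schmidt–Wingberg, *Cohomology of Number Fields*,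
Cor. 12.1.3, Prop. 12.1.9, Thm. 12.2.1.

PROOF-ONLY companion (0 `def`s) of `MLFGaloisGroups.lean` (abc-iut-L4-t4: `decompositionGroupNF F A`,
the stabiliser in `Γ_F = Gal(F̄/F)` of a valuation subring `A ≠ ⊤` of `F̄`) and of the trunk file
`NumberTheory/GaloisRepresentations/DecompositionGroupNested.lean` (the same statements for primes
of `\bar ℤ_F`).  Through the dictionary of `NFDecompositionCommTerminalProofs.lean`
(`exists_ideal_mem_primesAbove_of_ne_top`, `decompositionGroupNF_eq_decompositionSubgroup`) and
`Ideal.exists_mul_eq_of_mem_valuationSubring` (a valuation subring of `F̄` is recovered from its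
centre on `\bar ℤ_F`):

* `valuationSubring_le_of_forall_mem_iff` — two valuation subrings of `F̄` with the same centre
  `𝔓` on `\bar ℤ_F` coincide (`A = (\bar ℤ_F)_𝔓`);
* **`eq_of_decompositionGroupNF_le`** — for nonarchimedean primes `A, B ≠ ⊤` of `F̄`:
  `G_A ≤ G_B ⇒ A = B` ([NSW] Cor. 12.1.3, nested form); `eq_of_decompositionGroupNF_eq`;
* **`map_decompositionGroupNF_eq_of_forall_exists_le`** — for a group automorphism `α` of `Γ_F`:
  if `α` and `α⁻¹` map every `G_A` INTO some `G_B` (the cohomological containment lemma [NSW]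
  (12.1.9), an explicit hypothesis), then `α` maps every `G_A` ONTO some `G_B` — the conclusion of
  the «decomposition groups are permuted» form of Neukirch's theorem ([NSW] (12.2.1)); this is the
  group-theoretic step only.

Written for the abc-iut cell's GAP-LEDGER row G-L4d2g4-1 («campaign L»; the permutation statement
is consumed as a hypothesis by abc-iut-L4-d2's number-field shadow context and typed as a named
fact by abc-iut-w5-d201).  HONEST FRAMING: classical algebraic number theory; [NSW] (12.1.9)
itself is NOT proved here; nothing here bears on [IUTchIII] Cor. 3.12.
-/

noncomputable section

open scoped NumberField Pointwise
open Field IsDedekindDomain Literature.NumberTheory.GaloisRepresentations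

namespace Literature.AnabelianGeometry.AbsoluteAnabelian

variable {F : Type} [Field F] [NumberField F]

/-! ### A valuation subring of `F̄` is determined by its centre on `\bar ℤ_F` -/

/-- If the non-units of two valuation subrings `A`, `B` of `F̄` cut out the same ideal `𝔓` of
`\bar ℤ_F`, then `A ≤ B`: every `x ∈ A` is `s · t⁻¹` with `s, t ∈ \bar ℤ_F ⊆ B`, `t ∉ 𝔓`, so `t` is
a unit of `B` (`Ideal.exists_mul_eq_of_mem_valuationSubring`: `A = (\bar ℤ_F)_𝔓`).
Serre, *Local Fields*, Ch. I §7 Prop. 19–21; Zariski–Samuel II, Ch. VI §7 Thm. 12.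
[cite: SerreLocalFields1979, Ch. I §7 Prop. 19–21 and Ch. II §3 Cor. 4] -/
theorem valuationSubring_le_of_forall_mem_iff (A B : ValuationSubring (AlgebraicClosure F))
    (𝔓 : Ideal (absIntegers (𝓞 F) F))
    (hA : ∀ s : absIntegers (𝓞 F) F, s ∈ 𝔓 ↔ (s : AlgebraicClosure F) ∈ A.nonunits)
    (hB : ∀ s : absIntegers (𝓞 F) F, s ∈ 𝔓 ↔ (s : AlgebraicClosure F) ∈ B.nonunits) : A ≤ B := by
  intro x hx
  obtain ⟨s, t, ht, hxt⟩ :=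
    Ideal.exists_mul_eq_of_mem_valuationSubring (𝓞 F) (K := F) A 𝔓 hA hx
  have htB : (t : AlgebraicClosure F) ∈ B := coe_absIntegers_mem_valuationSubring B t
  have hsB : (s : AlgebraicClosure F) ∈ B := coe_absIntegers_mem_valuationSubring B s
  rw [hB, ValuationSubring.mem_nonunits_iff, not_lt] at ht
  have hval : B.valuation (t : AlgebraicClosure F) = 1 :=
    le_antisymm ((B.valuation_le_one_iff _).mpr htB) ht
  have ht0 : (t : AlgebraicClosure F) ≠ 0 := by
    intro h0
    rw [h0, map_zero] at hval
    exact zero_ne_one hval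
  have hinv : (t : AlgebraicClosure F)⁻¹ ∈ B := by
    rw [← B.valuation_le_one_iff, map_inv₀, hval, inv_one]
  have e : x = (s : AlgebraicClosure F) * (t : AlgebraicClosure F)⁻¹ := by
    rw [← hxt, mul_inv_cancel_right₀ ht0]
  rw [e]
  exact B.mul_mem _ _ hsB hinv

/-! ### Nested decomposition groups are equal -/

/-- **[NSW] Cor. 12.1.3, nested form, for nonarchimedean primes of `F̄`.**  For a number field `F`
and nontrivial valuation subrings `A, B ≠ ⊤` of `F̄`: `G_A ≤ G_B ⇒ A = B` (`G_A =
decompositionGroupNF F A`, the decomposition group of [AbsAnab] §1.1).  Via the primes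
`𝔓_A, 𝔓_B` of `\bar ℤ_F` cut out by `A, B` and `eq_of_decompositionSubgroup_le`
(`DecompositionGroupNested.lean`). [cite: NeukirchSchmidtWingberg2008, Cor. 12.1.3] -/
theorem eq_of_decompositionGroupNF_le (A B : ValuationSubring (AlgebraicClosure F)) (hA : A ≠ ⊤)
    (hB : B ≠ ⊤) (hle : decompositionGroupNF F A ≤ decompositionGroupNF F B) : A = B := by
  obtain ⟨v, 𝔓, h𝔓v, h𝔓⟩ := exists_ideal_mem_primesAbove_of_ne_top A hA
  obtain ⟨w, 𝔔, h𝔔w, h𝔔⟩ := exists_ideal_mem_primesAbove_of_ne_top B hB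
  rw [decompositionGroupNF_eq_decompositionSubgroup A 𝔓 h𝔓,
    decompositionGroupNF_eq_decompositionSubgroup B 𝔔 h𝔔] at hle
  have h := eq_of_decompositionSubgroup_le F h𝔓v h𝔔w hle
  subst h
  exact le_antisymm (valuationSubring_le_of_forall_mem_iff A B 𝔓 h𝔓 h𝔔)
    (valuationSubring_le_of_forall_mem_iff B A 𝔓 h𝔔 h𝔓)

/-- **Decomposition groups determine their prime**: `G_A = G_B ⇒ A = B` for nonarchimedean primes
`A, B ≠ ⊤` of `F̄`, `F` a number field. [cite: NeukirchSchmidtWingberg2008, Cor. 12.1.3] -/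
theorem eq_of_decompositionGroupNF_eq (A B : ValuationSubring (AlgebraicClosure F)) (hA : A ≠ ⊤)
    (hB : B ≠ ⊤) (heq : decompositionGroupNF F A = decompositionGroupNF F B) : A = B :=
  eq_of_decompositionGroupNF_le A B hA hB heq.le

/-! ### The group-theoretic step of Neukirch's theorem -/

/-- **From containment to equality** ([NSW] (12.1.9) ⇒ (12.2.1), group theory only).  Let `α` be
a group automorphism of `Γ_F`.  If `α` and `α⁻¹` map the decomposition group of every
nonarchimedean prime of `F̄` INTO the decomposition group of some nonarchimedean prime (the
cohomological lemma [NSW] Prop. 12.1.9 — an explicit hypothesis here, not proved), then `α` maps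
every decomposition group ONTO a decomposition group: `α(G_A) = G_B`.
[cite: NeukirchSchmidtWingberg2008, Thm. 12.2.1] -/
theorem map_decompositionGroupNF_eq_of_forall_exists_le
    (α : absoluteGaloisGroup F ≃* absoluteGaloisGroup F)
    (hα : ∀ A : ValuationSubring (AlgebraicClosure F), A ≠ ⊤ →
      ∃ B : ValuationSubring (AlgebraicClosure F), B ≠ ⊤ ∧
        (decompositionGroupNF F A).map α.toMonoidHom ≤ decompositionGroupNF F B)
    (hα' : ∀ A : ValuationSubring (AlgebraicClosure F), A ≠ ⊤ →
      ∃ B : ValuationSubring (AlgebraicClosure F), B ≠ ⊤ ∧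
        (decompositionGroupNF F A).map α.symm.toMonoidHom ≤ decompositionGroupNF F B)
    (A : ValuationSubring (AlgebraicClosure F)) (hA : A ≠ ⊤) :
    ∃ B : ValuationSubring (AlgebraicClosure F), B ≠ ⊤ ∧
      (decompositionGroupNF F A).map α.toMonoidHom = decompositionGroupNF F B := by
  obtain ⟨B, hB, hle⟩ := hα A hA
  obtain ⟨A', hA', hle'⟩ := hα' B hB
  refine ⟨B, hB, le_antisymm hle ?_⟩
  have h1 : decompositionGroupNF F A ≤ (decompositionGroupNF F B).map α.symm.toMonoidHom := by
    intro g hg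
    exact ⟨α g, hle ⟨g, hg, rfl⟩, by simp⟩
  have h2 := eq_of_decompositionGroupNF_le A A' hA hA' (h1.trans hle')
  subst h2
  intro g hg
  exact ⟨α.symm g, hle' ⟨g, hg, rfl⟩, by simp⟩

omit [NumberField F] in
/-- The same with `Γ_F` acting on valuation subrings POINTWISE (Mathlib's
`ValuationSubring.pointwiseMulAction` over the trunk's `MulSemiringAction (absoluteGaloisGroup F) F̄`):
`decompositionGroupNF F A` is the stabiliser `MulAction.stabilizer (absoluteGaloisGroup F) A` — the
spelling of the named fact requested for GAP G-L4d2g4-1 (abc-iut-L4-d2). [cite: MochizukiAbsAnab2004, §1.1 p.5] -/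
theorem decompositionGroupNF_eq_stabilizer (A : ValuationSubring (AlgebraicClosure F)) :
    decompositionGroupNF F A = MulAction.stabilizer (absoluteGaloisGroup F) A := by
  ext σ
  rfl

end Literature.AnabelianGeometry.AbsoluteAnabelian

end
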